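import Literature.AlgebraicGeometry.Motives.HodgeStructureCorrespondencesLefschetzGroup
import Literature.AlgebraicGeometry.Motives.HodgeStructureLefschetzGroupInvariantsHodgeClasses
import Literature.AlgebraicGeometry.Motives.MumfordTateGroupDiagonal
import HarnessLib

/-!
# Hodge correspondences: `u ∈ H^{2*}(A × B)` is a Hodge class iff `ū` commutes with the action of `Hg(A × B)`
# (the Hodge-group analogue of Milne 1999 Prop. 5.7; Moonen Prop. 4.4 / Cor. 4.5, Deligne 1982 Prop. 3.4)

[topic AlgebraicGeometry/Motives]

Layer `Literature/AlgebraicGeometry/Motives`, lane `lit-hodgefound` (Track 2 foundations library; prover seat `lit-hodgefound-p34`,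
generation 33, row g33-#14). THEOREMS ONLY (no `def`, no named fact, no instance, no notation; net debt `0`). The Hodge-class
companion of row g32-#3 (`Motives/HodgeStructureCorrespondencesLefschetzGroup`: "`u` is Lefschetz iff `ū` commutes with the actions of
`L(A × B)`", Milne Prop. 5.7), obtained by running the same argument with the Hodge group in place of the Lefschetz group:
"Hodge ⟺ fixed by `Hg`" (the tree's `mem_hodgeClasses_exteriorPower_iff_forall_hodgeGroupBaseChange_map_toComplexAlg_eq`, Deligne 1982
proof of Prop. 3.4 / Moonen Prop. 4.4) and "the map `u ↦ ū` is bijective and commutes with the action" (rows g32-#2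
`IsSymplectic.map_prodMap_eq_self_iff`, g32-#3 §1 `map_prodRight_map_blockDiag`), the elements of `Hg(H₁ ⊕ H₂)(ℂ)` being block
diagonal `γ₁ ⊕ γ₂` with `γᵢ ∈ Hg(Hᵢ)(ℂ)` (the tree's `hodgeGroupBaseChange_prod_le`, Moonen 1999 (1.13)) and `Hg(H₁)(ℂ) ≤ S(H₁)(ℂ)`
fixing the orientation `Θ E_{Q₁}` (g18-#1 `Polarization.hodgeGroupBaseChange_le_lefschetzGroupBaseChange`).

THE SETTING: `H₁`, `H₂` rational Hodge structures of the same odd weight `n` on `V₁`, `V₂` (`dim V₁ = 2g₁`), `Q₁` a polarization of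
`H₁` (only used to orient `H•(A) = ⋀V₁` by `E_{Q₁}`, `τ(E^{g₁}/g₁!) = 1`); `Θ` complexification, `β = prodRight`,
`ū_ℂ = corrMap (Θ E_{Q₁}) g₁ (⋀β (Θ u))` the realisation of the complexified class (row g32-#3 §2: `ū_ℂ (Θ x) = Θ (ū x)`).

## Sources, VERBATIM

J. S. Milne, *Lefschetz classes on abelian varieties*, Duke Math. J. 96 (1999) [Milne1999LefschetzClasses], §5 p. 664: "**Proposition 5.7.**
Let `A` and `B` be abelian varieties over `Ω`. A cohomological correspondence `u` between `A` and `B` is Lefschetz if and only if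
`ū : H^*(A) → H^*(B)` commutes with the actions of `L(A × B)`. […] Proof. The map `u ↦ ū` is bijective and commutes with the action of
`L(A × B)`, whence the first statement." and §4 p. 660: "`H^{2*}(A^r)(*)^{Hg(A)} = H(A^r)`".
B. Moonen, *An introduction to Mumford–Tate groups* (2004) [Moonen2004MT], §4: "**(4.4) Proposition.** […] `t` is a Hodge class if and
only if `t` is invariant under `MT(V)`." "**(4.5) Corollary.** […] a morphism of Hodge structures `W₁ → W₂` is the same as a Hodge class in
`Hom(W₁, W₂) = W₁^∨ ⊗ W₂`". B. Moonen, *Notes on Mumford–Tate groups* (1999) [Moonen1999MTNotes], (1.13): "`Hg(V₁ ⊕ V₂) ⊂ Hg(V₁) × Hg(V₂)`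
[…] if `V₁ = V₂` then `Hg(V)` is the diagonal subgroup".

So, exactly as in Milne's proof of Prop. 5.7 with `Hg` for `L`: a class `u ∈ ⋀ᵏ(V₁ ⊕ V₂)` (`p + p = k n`) is a Hodge class of
`⋀ᵏ(H₁ ⊕ H₂)` of type `(p, p)` iff `Θ u` is fixed by every `γ = γ₁ ⊕ γ₂ ∈ Hg(H₁ ⊕ H₂)(ℂ)`, iff (bijectivity and equivariance of
`u ↦ ū`, `γ₁` fixing `Θ E_{Q₁}`) `⋀γ₂ ∘ ū_ℂ = ū_ℂ ∘ ⋀γ₁` for all such `γ`.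

## What is PROVED

* §1 `blockDiag_mem_hodgeGroupBaseChange_prod` (`γ₁ ⊕ γ₂ ∈ Hg(H₁ ⊕ H₂)(K) ⟹ γᵢ ∈ Hg(Hᵢ)(K)`),
  **`Polarization.mem_hodgeClasses_exteriorPower_prod_iff_forall_blockDiag` — THE HODGE ANALOGUE OF PROP. 5.7, FIRST STATEMENT: `u` is a
  Hodge class of `⋀ᵏ(H₁ ⊕ H₂)` iff `⋀γ₂ ∘ ū_ℂ = ū_ℂ ∘ ⋀γ₁` for every `γ₁ ⊕ γ₂ ∈ Hg(H₁ ⊕ H₂)(ℂ)`**;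
* §2 **`Polarization.mem_hodgeClasses_exteriorPower_prod_self_iff_forall` — `A = B`: `u` is a Hodge class of `⋀ᵏ(H ⊕ H)` iff `ū_ℂ`
  commutes with `⋀γ` for every `γ ∈ Hg(H)(ℂ)`** ("`Hg(V ⊕ V)` is the diagonal");
* §3 the class of an operator: **`Polarization.mem_hodgeClasses_exteriorPower_prod_iff_of_eq_corrEquiv_symm`** (`u = [T]`, `T_ℂ Θ = Θ T`:
  `u` Hodge iff `⋀γ₂ ∘ T_ℂ = T_ℂ ∘ ⋀γ₁` on `Hg(H₁ ⊕ H₂)(ℂ)`) and **`Polarization.mem_hodgeClasses_exteriorPower_prod_self_iff_of_eq_corrEquiv_symm`**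
  (`A = B`: iff `T_ℂ` commutes with `⋀γ`, `γ ∈ Hg(H)(ℂ)`) — Moonen's Cor. 4.5 "a morphism of Hodge structures is the same as a Hodge class in
  `Hom`" for the cohomology algebras.

TWIN NOTICE (RULING 29 bis): the Lefschetz-group statements of row g32-#3 are used, not restated; no other carrier is touched.

## References

* [Milne1999LefschetzClasses] J. S. Milne, *Lefschetz classes on abelian varieties*, Duke Math. J. 96 (1999), §4 p. 660, §5 Prop. 5.7 (p. 664).
* [Moonen2004MT] B. Moonen, *An introduction to Mumford–Tate groups* (2004), §4 Prop. 4.4, Cor. 4.5, Lemma 4.6.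
* [Moonen1999MTNotes] B. Moonen, *Notes on Mumford–Tate groups* (1999), (1.12), (1.13).
* [Deligne1982HodgeCycles] P. Deligne, *Hodge cycles on abelian varieties* (1982), §3 proof of Prop. 3.4.
-/

open scoped TensorProduct

namespace Literature.AlgebraicGeometry.Motives

universe u

namespace HodgeStructure

open ExteriorLefschetz ExteriorAlgebra

variable {V₁ V₂ : Type u} [AddCommGroup V₁] [Module ℚ V₁] [Module.Finite ℚ V₁] [AddCommGroup V₂] [Module ℚ V₂] [Module.Finite ℚ V₂]
  [HodgeTensorFacts.{u, u}] {n : ℤ} {H₁ : HodgeStructure V₁ n} {H₂ : HodgeStructure V₂ n} (Q₁ : Polarization H₁) (hn : Odd n)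
  {g₁ : ℕ} (hg₁ : Module.finrank ℚ V₁ = 2 * g₁)

/-! ## §1 Hodge classes of `⋀ᵏ(H₁ ⊕ H₂)` ⟺ `ū` commutes with `Hg(H₁ ⊕ H₂)(ℂ)` -/

/-- **Moonen 1999 (1.13) for a block-diagonal element: `γ₁ ⊕ γ₂ ∈ Hg(H₁ ⊕ H₂)(K) ⟹ γ₁ ∈ Hg(H₁)(K)` and `γ₂ ∈ Hg(H₂)(K)`** (the tree's
`hodgeGroupBaseChange_prod_le` with `blockDiag` injective). [cite: Moonen1999MTNotes, (1.13)] [cite: Moonen2004MT, §4 Lemma 4.6] -/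
theorem blockDiag_mem_hodgeGroupBaseChange_prod (H₁ : HodgeStructure V₁ n) (H₂ : HodgeStructure V₂ n) (K : Type*) [Field K] [Algebra ℚ K] {γ₁ : (K ⊗[ℚ] V₁) ≃ₗ[K] (K ⊗[ℚ] V₁)} {γ₂ : (K ⊗[ℚ] V₂) ≃ₗ[K] (K ⊗[ℚ] V₂)}
    (hγ : blockDiag K V₁ V₂ (γ₁, γ₂) ∈ (H₁.prod H₂).hodgeGroupBaseChange K) :
    γ₁ ∈ H₁.hodgeGroupBaseChange K ∧ γ₂ ∈ H₂.hodgeGroupBaseChange K := by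
  obtain ⟨⟨γ₁', γ₂'⟩, ⟨hγ₁', hγ₂'⟩, hγ'⟩ := hodgeGroupBaseChange_prod_le hγ
  obtain ⟨h1, h2⟩ := Prod.mk.inj (blockDiag_injective hγ')
  subst h1 h2
  exact ⟨hγ₁', hγ₂'⟩

include hn hg₁ in
/-- **THE HODGE ANALOGUE OF MILNE'S PROP. 5.7, FIRST STATEMENT: a correspondence `u ∈ Hᵏ(A × B) = ⋀ᵏ(V₁ ⊕ V₂)` (`p + p = k n`) is a Hodge
class of type `(p, p)` iff `ū` commutes with the action of `Hg(A × B)`** — for every `γ₁ ⊕ γ₂ ∈ Hg(H₁ ⊕ H₂)(ℂ)`,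
`⋀γ₂ ∘ ū_ℂ = ū_ℂ ∘ ⋀γ₁`. Proof as Milne's: "Hodge ⟺ fixed by `Hg(A × B)`" (Deligne/Moonen Prop. 4.4, the tree's
`mem_hodgeClasses_exteriorPower_iff_forall_hodgeGroupBaseChange_map_toComplexAlg_eq`) and "`u ↦ ū` is bijective and commutes with the
action" (row g32-#2, `γ₁ ∈ Hg(H₁)(ℂ) ≤ S(H₁)(ℂ)` fixing `Θ E_{Q₁}`). [cite: Milne1999LefschetzClasses, §5 Prop. 5.7 (p. 664) and §4 p. 660]
[cite: Moonen2004MT, §4 Prop. 4.4 and Cor. 4.5] [cite: Moonen1999MTNotes, (1.12) and (1.13)] -/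
theorem Polarization.mem_hodgeClasses_exteriorPower_prod_iff_forall_blockDiag {k : ℕ} {p : ℤ} (hp : p + p = k * n)
    (u : ⋀[ℚ]^k (V₁ × V₂)) :
    u ∈ ((H₁.prod H₂).exteriorPower k).hodgeClasses p ↔
      ∀ (γ₁ : (ℂ ⊗[ℚ] V₁) ≃ₗ[ℂ] (ℂ ⊗[ℚ] V₁)) (γ₂ : (ℂ ⊗[ℚ] V₂) ≃ₗ[ℂ] (ℂ ⊗[ℚ] V₂)),
        blockDiag ℂ V₁ V₂ (γ₁, γ₂) ∈ (H₁.prod H₂).hodgeGroupBaseChange ℂ →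
          (ExteriorAlgebra.map (γ₂ : ℂ ⊗[ℚ] V₂ →ₗ[ℂ] ℂ ⊗[ℚ] V₂)).toLinearMap ∘ₗ
              corrMap (toComplexAlg V₁ (Q₁.lefschetzClass : ExteriorAlgebra ℚ V₁)) g₁
                (ExteriorAlgebra.map (TensorProduct.prodRight ℚ ℂ ℂ V₁ V₂).toLinearMap
                  (toComplexAlg (V₁ × V₂) (u : ExteriorAlgebra ℚ (V₁ × V₂)))) =
            corrMap (toComplexAlg V₁ (Q₁.lefschetzClass : ExteriorAlgebra ℚ V₁)) g₁
                (ExteriorAlgebra.map (TensorProduct.prodRight ℚ ℂ ℂ V₁ V₂).toLinearMap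
                  (toComplexAlg (V₁ × V₂) (u : ExteriorAlgebra ℚ (V₁ × V₂)))) ∘ₗ
              (ExteriorAlgebra.map (γ₁ : ℂ ⊗[ℚ] V₁ →ₗ[ℂ] ℂ ⊗[ℚ] V₁)).toLinearMap := by
  rw [mem_hodgeClasses_exteriorPower_iff_forall_hodgeGroupBaseChange_map_toComplexAlg_eq (H₁.prod H₂) hp u]
  have hE := Q₁.isSymplectic_toComplexAlg_lefschetzClass hn hg₁
  constructor
  · intro h γ₁ γ₂ hγ
    have hγ₁ : γ₁ ∈ Q₁.lefschetzGroupBaseChange ℂ :=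
      Q₁.hodgeGroupBaseChange_le_lefschetzGroupBaseChange ℂ (blockDiag_mem_hodgeGroupBaseChange_prod H₁ H₂ ℂ hγ).1
    have h2 : ExteriorAlgebra.map ((γ₁ : ℂ ⊗[ℚ] V₁ →ₗ[ℂ] ℂ ⊗[ℚ] V₁).prodMap (γ₂ : ℂ ⊗[ℚ] V₂ →ₗ[ℂ] ℂ ⊗[ℚ] V₂))
        (ExteriorAlgebra.map (TensorProduct.prodRight ℚ ℂ ℂ V₁ V₂).toLinearMap
          (toComplexAlg (V₁ × V₂) (u : ExteriorAlgebra ℚ (V₁ × V₂)))) =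
        ExteriorAlgebra.map (TensorProduct.prodRight ℚ ℂ ℂ V₁ V₂).toLinearMap
          (toComplexAlg (V₁ × V₂) (u : ExteriorAlgebra ℚ (V₁ × V₂))) := by
      rw [← map_prodRight_map_blockDiag, h _ hγ]
    exact (hE.map_prodMap_eq_self_iff (Q₁.map_toComplexAlg_lefschetzClass_eq_of_mem_lefschetzGroupBaseChange hn hγ₁) _ _).1 h2
  · intro h γ hγ
    obtain ⟨⟨γ₁, γ₂⟩, ⟨hγ₁, -⟩, hγ'⟩ := hodgeGroupBaseChange_prod_le hγ
    rw [← hγ'] at hγ ⊢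
    have h2 := (hE.map_prodMap_eq_self_iff
      (Q₁.map_toComplexAlg_lefschetzClass_eq_of_mem_lefschetzGroupBaseChange hn
        (Q₁.hodgeGroupBaseChange_le_lefschetzGroupBaseChange ℂ hγ₁))
      (γ₂ : ℂ ⊗[ℚ] V₂ →ₗ[ℂ] ℂ ⊗[ℚ] V₂)
      (ExteriorAlgebra.map (TensorProduct.prodRight ℚ ℂ ℂ V₁ V₂).toLinearMap
        (toComplexAlg (V₁ × V₂) (u : ExteriorAlgebra ℚ (V₁ × V₂))))).2 (h γ₁ γ₂ hγ)
    apply map_equiv_injective (TensorProduct.prodRight ℚ ℂ ℂ V₁ V₂)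
    rw [map_prodRight_map_blockDiag, h2]

/-! ## §2 `A = B`: `ū` commutes with the diagonal `Hg(H)(ℂ)` -/

include hn hg₁ in
/-- **`A = B`: `u ∈ ⋀ᵏ(V ⊕ V)` is a Hodge class of `⋀ᵏ(H ⊕ H)` iff `ū_ℂ` commutes with `⋀γ` for every `γ ∈ Hg(H)(ℂ)`** ("if `V₁ = V₂` then
`Hg(V)` is the diagonal subgroup", the tree's `hodgeGroupBaseChange_prod_self_eq`). [cite: Moonen1999MTNotes, (1.13)]
[cite: Milne1999LefschetzClasses, §5 Prop. 5.7 (p. 664) and §4 p. 660 ("H^{2*}(A^r)(*)^{Hg(A)} = H(A^r)")] -/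
theorem Polarization.mem_hodgeClasses_exteriorPower_prod_self_iff_forall {k : ℕ} {p : ℤ} (hp : p + p = k * n)
    (u : ⋀[ℚ]^k (V₁ × V₁)) :
    u ∈ ((H₁.prod H₁).exteriorPower k).hodgeClasses p ↔
      ∀ γ ∈ H₁.hodgeGroupBaseChange ℂ,
        (ExteriorAlgebra.map (γ : ℂ ⊗[ℚ] V₁ →ₗ[ℂ] ℂ ⊗[ℚ] V₁)).toLinearMap ∘ₗ
            corrMap (toComplexAlg V₁ (Q₁.lefschetzClass : ExteriorAlgebra ℚ V₁)) g₁
              (ExteriorAlgebra.map (TensorProduct.prodRight ℚ ℂ ℂ V₁ V₁).toLinearMap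
                (toComplexAlg (V₁ × V₁) (u : ExteriorAlgebra ℚ (V₁ × V₁)))) =
          corrMap (toComplexAlg V₁ (Q₁.lefschetzClass : ExteriorAlgebra ℚ V₁)) g₁
              (ExteriorAlgebra.map (TensorProduct.prodRight ℚ ℂ ℂ V₁ V₁).toLinearMap
                (toComplexAlg (V₁ × V₁) (u : ExteriorAlgebra ℚ (V₁ × V₁)))) ∘ₗ
            (ExteriorAlgebra.map (γ : ℂ ⊗[ℚ] V₁ →ₗ[ℂ] ℂ ⊗[ℚ] V₁)).toLinearMap := by
  rw [Q₁.mem_hodgeClasses_exteriorPower_prod_iff_forall_blockDiag hn hg₁ hp]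
  constructor
  · intro h γ hγ
    refine h γ γ ?_
    rw [← diagEmbedding_apply]
    exact diagEmbedding_mem_hodgeGroupBaseChange ℂ hγ
  · intro h γ₁ γ₂ hγ
    obtain ⟨γ, hγ', heq⟩ := (mem_hodgeGroupBaseChange_prod_self_iff ℂ).1 hγ
    rw [diagEmbedding_apply] at heq
    obtain ⟨h1, h2⟩ := Prod.mk.inj (blockDiag_injective heq)
    subst h1 h2
    exact h γ hγ'

/-! ## §3 The class of an operator: `[T]` is Hodge iff `T_ℂ` is `Hg`-equivariant (Moonen Cor. 4.5 for `H•`) -/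

include hn hg₁ in
/-- **A HODGE CLASS ON `A × B` IS THE SAME AS AN `Hg(A × B)`-EQUIVARIANT MAP `H•(A) → H•(B)`**: if the homogeneous class `u ∈ ⋀ᵏ(V₁ ⊕ V₂)`
(`p + p = k n`) is the class `[T]` of an operator `T : ⋀_ℚ V₁ → ⋀_ℚ V₂` and `T_ℂ` is a `ℂ`-linear extension (`T_ℂ Θ = Θ T`), then `u` is a
Hodge class of type `(p, p)` iff `⋀γ₂ ∘ T_ℂ = T_ℂ ∘ ⋀γ₁` for every `γ₁ ⊕ γ₂ ∈ Hg(H₁ ⊕ H₂)(ℂ)` (§1 with row g32-#3's `⋀β Θ [T] = [T_ℂ]`).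
[cite: Moonen2004MT, §4 Cor. 4.5 ("a morphism of Hodge structures W₁ → W₂ is the same as a Hodge class in Hom(W₁, W₂)")]
[cite: Milne1999LefschetzClasses, §5 Prop. 5.7 (p. 664)] -/
theorem Polarization.mem_hodgeClasses_exteriorPower_prod_iff_of_eq_corrEquiv_symm {k : ℕ} {p : ℤ} (hp : p + p = k * n)
    {u : ⋀[ℚ]^k (V₁ × V₂)} {T : ExteriorAlgebra ℚ V₁ →ₗ[ℚ] ExteriorAlgebra ℚ V₂}
    (hu : (u : ExteriorAlgebra ℚ (V₁ × V₂)) = (Q₁.isSymplectic_lefschetzClass hn hg₁).corrEquiv.symm T)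
    {T' : ExteriorAlgebra ℂ (ℂ ⊗[ℚ] V₁) →ₗ[ℂ] ExteriorAlgebra ℂ (ℂ ⊗[ℚ] V₂)} (hT : ∀ x, T' (toComplexAlg V₁ x) = toComplexAlg V₂ (T x)) :
    u ∈ ((H₁.prod H₂).exteriorPower k).hodgeClasses p ↔
      ∀ (γ₁ : (ℂ ⊗[ℚ] V₁) ≃ₗ[ℂ] (ℂ ⊗[ℚ] V₁)) (γ₂ : (ℂ ⊗[ℚ] V₂) ≃ₗ[ℂ] (ℂ ⊗[ℚ] V₂)),
        blockDiag ℂ V₁ V₂ (γ₁, γ₂) ∈ (H₁.prod H₂).hodgeGroupBaseChange ℂ →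
          (ExteriorAlgebra.map (γ₂ : ℂ ⊗[ℚ] V₂ →ₗ[ℂ] ℂ ⊗[ℚ] V₂)).toLinearMap ∘ₗ T' =
            T' ∘ₗ (ExteriorAlgebra.map (γ₁ : ℂ ⊗[ℚ] V₁ →ₗ[ℂ] ℂ ⊗[ℚ] V₁)).toLinearMap := by
  rw [Q₁.mem_hodgeClasses_exteriorPower_prod_iff_forall_blockDiag hn hg₁ hp, hu,
    (Q₁.isSymplectic_lefschetzClass hn hg₁).map_prodRight_toComplexAlg_corrEquiv_symm
      (Q₁.isSymplectic_toComplexAlg_lefschetzClass hn hg₁) hT, IsSymplectic.corrMap_corrEquiv_symm]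

include hn hg₁ in
/-- **`A = B`: `[T]` (homogeneous, `p + p = k n`) is a Hodge class of `⋀ᵏ(H ⊕ H)` iff `T_ℂ` commutes with `⋀γ` for every `γ ∈ Hg(H)(ℂ)`** —
the form in which "the projector `H^*(A) → H^s(A)` / `L` / `Λ` commutes with `Hg(A)`, hence its class is a Hodge class" is applied.
[cite: Moonen2004MT, §4 Cor. 4.5] [cite: Milne1999LefschetzClasses, §5 Prop. 5.7 and Cor. 5.8 (p. 664)] [cite: Moonen1999MTNotes, (1.13)] -/
theorem Polarization.mem_hodgeClasses_exteriorPower_prod_self_iff_of_eq_corrEquiv_symm {k : ℕ} {p : ℤ} (hp : p + p = k * n)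
    {u : ⋀[ℚ]^k (V₁ × V₁)} {T : ExteriorAlgebra ℚ V₁ →ₗ[ℚ] ExteriorAlgebra ℚ V₁}
    (hu : (u : ExteriorAlgebra ℚ (V₁ × V₁)) = (Q₁.isSymplectic_lefschetzClass hn hg₁).corrEquiv.symm T)
    {T' : ExteriorAlgebra ℂ (ℂ ⊗[ℚ] V₁) →ₗ[ℂ] ExteriorAlgebra ℂ (ℂ ⊗[ℚ] V₁)} (hT : ∀ x, T' (toComplexAlg V₁ x) = toComplexAlg V₁ (T x)) :
    u ∈ ((H₁.prod H₁).exteriorPower k).hodgeClasses p ↔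
      ∀ γ ∈ H₁.hodgeGroupBaseChange ℂ,
        (ExteriorAlgebra.map (γ : ℂ ⊗[ℚ] V₁ →ₗ[ℂ] ℂ ⊗[ℚ] V₁)).toLinearMap ∘ₗ T' =
          T' ∘ₗ (ExteriorAlgebra.map (γ : ℂ ⊗[ℚ] V₁ →ₗ[ℂ] ℂ ⊗[ℚ] V₁)).toLinearMap := by
  rw [Q₁.mem_hodgeClasses_exteriorPower_prod_self_iff_forall hn hg₁ hp, hu,
    (Q₁.isSymplectic_lefschetzClass hn hg₁).map_prodRight_toComplexAlg_corrEquiv_symm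
      (Q₁.isSymplectic_toComplexAlg_lefschetzClass hn hg₁) hT, IsSymplectic.corrMap_corrEquiv_symm]

end HodgeStructure

end Literature.AlgebraicGeometry.Motives
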